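import Mathlib
import Literature.Computability.AlgebraicComplexity.NarayananElusive
import Literature.Computability.AlgebraicComplexity.NarayananElusiveProofs
import Summits.ValiantsHypothesis.ValiantsHypothesis.Theses.GirthSidon
import Summits.ValiantsHypothesis.ValiantsHypothesis.Theorems.GirthSidonMomentCurveElusiveHilbertCount
import Summits.ValiantsHypothesis.ValiantsHypothesis.Theorems.GirthSidonMomentCurveElusiveMonomialNumericToPuiseux

/-!
# GirthSidon — the Hilbert count at exponential height: formal (and pointwise) elusiveness of the
doubling exponents at LINEAR source count
(helper lemmas for the crux `MomentCurveElusive`, item `stmt-ValiantsHypothesis-6534`, line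
`registered`; calibration of the Hilbert-function technique of
`GirthSidonMomentCurveElusiveHilbertCount.lean`, which they refine from multisets to sets)

If `t^{D_i} ∈ V · V` (`i < m`, `V ⊂ K((t))` finite-dimensional) and distinct `h`-SUBSETS of indices
have distinct `D`-sums, then the `C(m, h)` monomials `∏_{i ∈ S} t^{D_i}` are distinct, hence linearly
independent, inside the span of `2h`-fold products of elements of `V`, so

  `C(m, h) ≤ C(finrank V + 2h - 1, 2h)`      (`choose_le_choose_of_subsetSum_injective`).

With `h = s + 1 ≥ finrank V` this forces `m ≤ 3s + 2` whenever ALL subset sums of `D` are distinct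
(`le_of_formalSwallow_subsetSum_injective`: `C(3s+3, s+1) > C(3s+2, s) = C(3s+2, 2s+2)`).  Hence:

* `helper_formalDoublingLinear` — no quadratic map on `s` Laurent-series sources swallows the
  monomial vector `(t^{N·2^i})_{i<m}` formally unless `m ≤ 3s + 2`;
* `isElusive_doublingCurve_of_le` — Narayanan's doubling curve `z ↦ (z^{2^i})_{i<m}` is
  `(s, 2)`-elusive for every `s` with `3s + 3 ≤ m` (pointwise non-elusiveness transfers to a formal
  swallowing of `(t^{N 2^i})` by the landed `stub_monomialNumericToPuiseux`).  Narayanan 2026, Thm. 1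
  (tree: `isElusive_doublingCurve_of_pow_lt`, hypothesis `(2m+1)^s < 2^m`, i.e. `s < m / log₂(2m+1)`)
  counts all `2^m` square-free products in `ℂ[z]` of degree `≤ 2m` per variable; counting only the
  `C(m, s+1)` products of `s + 1` coordinates against `dim ℂ[z]_{≤ 2s+2} = C(3s+2, 2s+2)` gives the
  linear range.  This is where the Hilbert-function technique lives: exponential height, any `s` up to
  `m/3`; at the route's polynomial height it stops at `s ≈ 6.7 √m` (previous file).
-/

-- `Summit.ValiantsHypothesis.ValiantsHypothesis.…` is the tree's mandated single-conjunct layout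
-- (Sub = Summit), so the duplicated namespace component is intended.
set_option linter.dupNamespace false

namespace Summit.ValiantsHypothesis.ValiantsHypothesis.Theorems

open scoped Pointwise

section SubsetSums

variable {K : Type*} [Field K]

/-- **Hilbert count, subset version.** Let `V ⊂ K((t))` be finite-dimensional and let
`t^{D_i} ∈ V · V` (`i < m`) be monomials such that distinct `h`-subsets of indices have distinct
`D`-sums.  Then `C(m, h) ≤ C(finrank V + 2h - 1, 2h)`: the products `∏_{i∈S} t^{D_i}` over `h`-subsets
`S` are distinct monomials, hence linearly independent, in the span of the `2h`-fold products of
elements of `V`. [cite: Narayanan2026, §2 (proof of Thm. 1)] -/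
theorem choose_le_choose_of_subsetSum_injective (V : Submodule K (LaurentSeries K))
    [FiniteDimensional K V] {m : ℕ} (D : Fin m → ℤ) (h : ℕ)
    (hmem : ∀ i, HahnSeries.single (D i) (1 : K) ∈
      Submodule.span K ((V : Set (LaurentSeries K)) * (V : Set (LaurentSeries K))))
    (hinj : ∀ S T : Finset (Fin m), S.card = h → T.card = h →
      (∑ i ∈ S, D i) = (∑ i ∈ T, D i) → S = T) :
    m.choose h ≤ (Module.finrank K V + 2 * h - 1).choose (2 * h) := by
  classical
  set W := Submodule.span K (Set.range (fun v : Fin (2 * h) → V => ∏ j, (v j : LaurentSeries K)))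
    with hW
  haveI : FiniteDimensional K W := finiteDimensional_span_range_prod V (2 * h)
  set P := Finset.powersetCard h (Finset.univ : Finset (Fin m)) with hP
  -- the products of the monomials over `h`-subsets
  let F : P → LaurentSeries K := fun S => HahnSeries.single (∑ i ∈ (S : Finset (Fin m)), D i) (1 : K)
  have hcardS : ∀ S : P, (S : Finset (Fin m)).card = h := fun S =>
    (Finset.mem_powersetCard.1 S.2).2
  have hFmem : ∀ S, F S ∈ W := by
    intro S
    have hprod := multiset_prod_mem_span_range_prod V
      ((S : Finset (Fin m)).val.map fun i => HahnSeries.single (D i) (1 : K))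
      (by
        intro x hx
        rw [Multiset.mem_map] at hx
        obtain ⟨i, _, rfl⟩ := hx
        exact hmem i)
    have hc : Multiset.card ((S : Finset (Fin m)).val.map fun i => HahnSeries.single (D i) (1 : K)) =
        h := by rw [Multiset.card_map, Finset.card_val, hcardS]
    rw [hc] at hprod
    have hF : ((S : Finset (Fin m)).val.map fun i => HahnSeries.single (D i) (1 : K)).prod = F S := by
      simp only [F]
      rw [Finset.sum_eq_multiset_sum, ← multiset_prod_map_single_one, Multiset.map_map]
      rfl
    rwa [hF] at hprod
  -- they are linearly independent (distinct orders)
  have hli : LinearIndependent K (fun S => (⟨F S, hFmem S⟩ : W)) := by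
    apply LinearIndependent.of_comp W.subtype
    refine linearIndependent_of_order_injective (fun S => F S) (fun S => by simp [F]) ?_
    intro S T hST
    simp only [F, HahnSeries.order_single one_ne_zero] at hST
    exact Subtype.ext (hinj _ _ (hcardS S) (hcardS T) hST)
  have hcard := hli.fintype_card_le_finrank
  rw [Fintype.card_coe, hP, Finset.card_powersetCard, Finset.card_univ, Fintype.card_fin] at hcard
  exact hcard.trans (finrank_span_range_prod_le V (2 * h))

/-- The binomial inequality behind the linear range: `C(3s+2, 2s+2) < C(m, s+1)` once `3s + 3 ≤ m`
(`C(3s+3, s+1) = C(3s+2, s) + C(3s+2, s+1)` and `C(3s+2, 2s+2) = C(3s+2, s)`). [folklore] -/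
theorem choose_three_mul_lt {s m : ℕ} (hm : 3 * s + 3 ≤ m) :
    (3 * s + 2).choose (2 * s + 2) < m.choose (s + 1) := by
  have hsymm : (3 * s + 2).choose (2 * s + 2) = (3 * s + 2).choose s :=
    Nat.choose_symm_of_eq_add (by ring)
  have hsucc : (3 * s + 3).choose (s + 1) = (3 * s + 2).choose s + (3 * s + 2).choose (s + 1) :=
    Nat.choose_succ_succ' (3 * s + 2) s
  have hpos : 0 < (3 * s + 2).choose (s + 1) := Nat.choose_pos (by omega)
  have hmono : (3 * s + 3).choose (s + 1) ≤ m.choose (s + 1) := Nat.choose_le_choose _ hm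
  omega

/-- **Linear range of the Hilbert count for subset-sum-distinct exponents.** If a quadratic map on
`s` Laurent-series sources swallows `(t^{d_i})_{i<m}` formally and ALL subset sums of `d` are
distinct, then `m ≤ 3s + 2` (apply `choose_le_choose_of_subsetSum_injective` with `h = s + 1` to
`V = span(1, y)`, `finrank V ≤ s + 1`, and compare with `choose_three_mul_lt`).
[cite: Narayanan2026, §2 (proof of Thm. 1)] -/
theorem le_of_formalSwallow_subsetSum_injective {s m : ℕ} (y : Fin s → LaurentSeries K)
    (d : Fin m → ℕ) (Γ : Fin m → MvPolynomial (Fin s) K) (hΓ : ∀ i, (Γ i).totalDegree ≤ 2)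
    (hy : ∀ i, MvPolynomial.aeval y (Γ i) = HahnSeries.single (d i : ℤ) (1 : K))
    (hinj : ∀ S T : Finset (Fin m), (∑ i ∈ S, d i) = (∑ i ∈ T, d i) → S = T) :
    m ≤ 3 * s + 2 := by
  classical
  by_contra hlt
  push Not at hlt
  -- the source space `V = span(1, y)` has `finrank ≤ s + 1`
  set g : Option (Fin s) → LaurentSeries K := fun o => o.elim 1 y with hg
  have hrange : Set.range g = insert 1 (Set.range y) := by
    ext x
    simp only [hg, Set.mem_range, Set.mem_insert_iff]
    constructor
    · rintro ⟨o, rfl⟩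
      cases o with
      | none => exact Or.inl rfl
      | some j => exact Or.inr ⟨j, rfl⟩
    · rintro (rfl | ⟨j, rfl⟩)
      · exact ⟨none, rfl⟩
      · exact ⟨some j, rfl⟩
  set V := Submodule.span K (insert 1 (Set.range y)) with hV
  haveI : FiniteDimensional K V := by
    rw [hV, ← hrange]; exact FiniteDimensional.span_of_finite K (Set.finite_range g)
  have hfin : Module.finrank K V ≤ s + 1 := by
    have h := finrank_range_le_card (R := K) g
    rw [hrange] at h
    simpa [Set.finrank] using h
  have h1 : (1 : LaurentSeries K) ∈ V := Submodule.subset_span (Set.mem_insert _ _)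
  have hyV : ∀ j, y j ∈ V := fun j => Submodule.subset_span (Set.mem_insert_of_mem _ ⟨j, rfl⟩)
  have hmem : ∀ i, HahnSeries.single ((fun i => (d i : ℤ)) i) (1 : K) ∈
      Submodule.span K ((V : Set (LaurentSeries K)) * (V : Set (LaurentSeries K))) := by
    intro i
    rw [← hy i]
    exact aeval_mem_mul_self_of_totalDegree_le_two y V h1 hyV (Γ i) (hΓ i)
  have hinj' : ∀ S T : Finset (Fin m), S.card = s + 1 → T.card = s + 1 →
      (∑ i ∈ S, (fun i => (d i : ℤ)) i) = (∑ i ∈ T, (fun i => (d i : ℤ)) i) → S = T := by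
    intro S T _ _ hsum
    refine hinj S T ?_
    have hsum' : ((∑ i ∈ S, d i : ℕ) : ℤ) = ((∑ i ∈ T, d i : ℕ) : ℤ) := by push_cast; exact hsum
    exact_mod_cast hsum'
  have hcount := choose_le_choose_of_subsetSum_injective V (fun i => (d i : ℤ)) (s + 1) hmem hinj'
  have hmono : (Module.finrank K V + 2 * (s + 1) - 1).choose (2 * (s + 1)) ≤
      (3 * s + 2).choose (2 * s + 2) := by
    have h2 : 2 * (s + 1) = 2 * s + 2 := by ring
    rw [h2]
    exact Nat.choose_le_choose _ (by omega)
  have hlt' := choose_three_mul_lt (s := s) (m := m) (by omega)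
  omega

/-- Subset sums of `i ↦ N · 2^i` on `Fin m` are distinct for `N ≥ 1` (uniqueness of binary
expansion, `doublingExp_injective`). [folklore] -/
theorem doublingScaled_subsetSum_injective (m N : ℕ) (hN : 0 < N) :
    ∀ S T : Finset (Fin m), (∑ i ∈ S, N * 2 ^ (i : ℕ)) = (∑ i ∈ T, N * 2 ^ (i : ℕ)) → S = T := by
  intro S T h
  rw [← Finset.mul_sum, ← Finset.mul_sum] at h
  exact Literature.Computability.AlgebraicComplexity.doublingExp_injective m
    (Nat.eq_of_mul_eq_mul_left hN h)

/-- **Formal elusiveness of the doubling exponents at linear source count, registered helper form**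
(sub-goal `helper_formalDoublingLinear` of item `stmt-ValiantsHypothesis-6534`): if a quadratic map on
`s` Laurent-series sources swallows `(t^{N·2^i})_{i<m}` formally (`N ≥ 1`), then `m ≤ 3s + 2`.
[cite: Narayanan2026, §2 (proof of Thm. 1)] -/
theorem helper_formalDoublingLinear : ∀ (s m N : ℕ) (y : Fin s → LaurentSeries ℂ) (Γ : Fin m → MvPolynomial (Fin s) ℂ), 0 < N → (∀ i, (Γ i).totalDegree ≤ 2) → (∀ i : Fin m, MvPolynomial.aeval y (Γ i) = HahnSeries.single ((N * 2 ^ (i : ℕ) : ℕ) : ℤ) (1 : ℂ)) → m ≤ 3 * s + 2 := by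
  intro s m N y Γ hN hΓ hy
  exact le_of_formalSwallow_subsetSum_injective y (fun i : Fin m => N * 2 ^ (i : ℕ)) Γ hΓ hy
    (doublingScaled_subsetSum_injective m N hN)

/-- **Narayanan's doubling curve is `(s,2)`-elusive for all `s` with `3s + 3 ≤ m`** (linear range;
Narayanan 2026 Thm. 1 as printed asks `(2m+1)^s < 2^m`).  A pointwise swallower gives, by the
numeric-to-Puiseux transfer `stub_monomialNumericToPuiseux` (GMOW 2019 Lemma 9.3 + Newton–Puiseux), a
formal swallowing of `(t^{N 2^i})_{i<m}`, contradicting `helper_formalDoublingLinear`.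
[cite: Narayanan2026, Thm. 1 and §2] -/
theorem isElusive_doublingCurve_of_le {m s : ℕ} (hm : 3 * s + 3 ≤ m) :
    Literature.Computability.AlgebraicComplexity.IsElusive
      (Literature.Computability.AlgebraicComplexity.doublingCurve m) s 2 := by
  by_contra hne
  obtain ⟨N, Γ, y, hN, hΓ, hy⟩ := stub_monomialNumericToPuiseux m s (fun i : Fin m => 2 ^ (i : ℕ)) hne
  have := helper_formalDoublingLinear s m N y Γ hN hΓ hy
  omega

end SubsetSums

end Summit.ValiantsHypothesis.ValiantsHypothesis.Theorems
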